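import Summits.AtomisticToContinuum.FouriersLaw.Theorems.BondHeatUncertaintyBoundedResponseThermalScalingA
import HarnessLib

/-!
# NODE 98N «ThermalScaling» (lens-1 g98) — part 2 of 2 (sequel of `…BondHeatUncertaintyBoundedResponseThermalScalingA`)

Split for the 400-line cap by the landing lane (hand-2 g36); the module docstring of part 1 describes the whole node.  Same namespace; `section ThermalScaling` and
`variable {N : ℕ}` re-opened; all FQNs unchanged.  0 sorry; standard axioms.
-/

noncomputable section

open MeasureTheory ProbabilityTheory Filter Topology Set Function
open scoped NNReal ENNReal
open Literature.MathematicalPhysics.KineticTheory.HeatConduction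
open Literature.MathematicalPhysics.KineticTheory OscillatorChain
open Summit.AtomisticToContinuum.FouriersLaw.Theorems.SubdiffusiveBondHeat
open Summit.AtomisticToContinuum.FouriersLaw.Theorems.BoundedResponse.TransientBand
open Literature.Barriers.AtomisticToContinuum.HeatConduction (hamiltonian_smul)

namespace Summit.AtomisticToContinuum.FouriersLaw.Theorems.BoundedResponse.ParityFloor

open Summit.AtomisticToContinuum.FouriersLaw.Theses.BondHeatUncertainty (BoundedResponse)
open Summit.AtomisticToContinuum.FouriersLaw.Theorems.SubdiffusiveBondHeat.EscapeGrading
open Literature.Probability.Process (WienerPair pairPath wienerPair)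
open Literature.Analysis.ODE (IsIntegralSolutionOn)

section ThermalScaling

variable {N : ℕ}

/-! ## §4 The escape currency of door v9 -/

/-- `P_{t⁺}θ_b` has weight two: `(P^{c²T}_t θ^{c²T}_b)(c·z) = c²·(P^{T}_t θ^{T}_b)(z)` (couplings `(lam,β) ↦ (lam c², β c²)`).
[folklore] -/
theorem kinAct_smul {ω₂ lam β γ : ℝ} (hω : 0 < ω₂) (hl : 0 ≤ lam) (hβ : 0 ≤ β) (hγ : 0 ≤ γ)
    {c : ℝ} (hc : 0 < c) (T : ℝ) (N : ℕ) (b : Fin N) (t : ℝ) (z : PhaseSpace N) :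
    kinAct ω₂ lam β γ (c ^ 2 * T) N b t (c • z) = c ^ 2 * kinAct ω₂ (lam * c ^ 2) (β * c ^ 2) γ T N b t z := by
  unfold kinAct
  rw [integral_transitionKernel_smul hω hl hβ hγ hc]
  simp only [kinObs_smul]
  exact integral_const_mul _ _

/-- The Kubo corrector has weight two: `h^{c²T}_b(c·z) = c²·h^{T}_b(z)`. [folklore] -/
theorem kinCorrector_smul {ω₂ lam β γ : ℝ} (hω : 0 < ω₂) (hl : 0 ≤ lam) (hβ : 0 ≤ β) (hγ : 0 ≤ γ)
    {c : ℝ} (hc : 0 < c) (T : ℝ) (N : ℕ) (b : Fin N) (z : PhaseSpace N) :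
    kinCorrector ω₂ lam β γ (c ^ 2 * T) N b (c • z) = c ^ 2 * kinCorrector ω₂ (lam * c ^ 2) (β * c ^ 2) γ T N b z := by
  unfold kinCorrector
  simp only [kinAct_smul hω hl hβ hγ hc]
  exact integral_const_mul _ _

/-- **The escape kernel scales by `c⁴`**: `K^{lam,β}_N(u; c²T) = c⁴ · K^{lam c²,β c²}_N(u; T)` — the finite-chain, Langevin-bath
form of the covariance scaling (2.11) of Aoki–Lukkarinen–Spohn (no time rescaling). [cite: AokiLukkarinenSpohn2006, §2 eqs. (2.8)-(2.11)] -/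
theorem escapeKernel_smul {ω₂ lam β γ : ℝ} (hω : 0 < ω₂) (hl : 0 ≤ lam) (hβ : 0 ≤ β) (hγ : 0 ≤ γ)
    {c : ℝ} (hc : 0 < c) (T : ℝ) (N : ℕ) (u : ℝ) :
    escapeKernel ω₂ lam β γ (c ^ 2 * T) N u = c ^ 4 * escapeKernel ω₂ (lam * c ^ 2) (β * c ^ 2) γ T N u := by
  unfold escapeKernel
  split_ifs with hN
  · have hpt : ∀ z : PhaseSpace N, (c • z).2 ⟨0, hN⟩ ^ 2 - c ^ 2 * T = c ^ 2 * (z.2 ⟨0, hN⟩ ^ 2 - T) := fun z => by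
      simp only [Prod.smul_snd, Pi.smul_apply, smul_eq_mul]; ring
    simp only [integral_gibbsMeasure_smul ω₂ lam β γ hc.ne', integral_transitionKernel_smul hω hl hβ hγ hc, hpt,
      integral_const_mul]
    rw [← integral_const_mul]
    refine integral_congr_ae (Filter.Eventually.of_forall fun z => ?_)
    ring
  · simp

/-- **The cross kernel scales by `c⁴`**: `K×^{lam,β}_N(u; c²T) = c⁴ · K×^{lam c²,β c²}_N(u; T)`. [folklore] -/
theorem crossKernel_smul {ω₂ lam β γ : ℝ} (hω : 0 < ω₂) (hl : 0 ≤ lam) (hβ : 0 ≤ β) (hγ : 0 ≤ γ)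
    {c : ℝ} (hc : 0 < c) (T : ℝ) (N : ℕ) (u : ℝ) :
    crossKernel ω₂ lam β γ (c ^ 2 * T) N u = c ^ 4 * crossKernel ω₂ (lam * c ^ 2) (β * c ^ 2) γ T N u := by
  unfold crossKernel
  split_ifs with hN
  · simp only [integral_gibbsMeasure_smul ω₂ lam β γ hc.ne', kinObs_smul, kinAct_smul hω hl hβ hγ hc]
    rw [← integral_const_mul]
    refine integral_congr_ae (Filter.Eventually.of_forall fun z => ?_)
    ring
  · simp

/-- The Green–Kubo prefactor absorbs the kernel weight: `γ/(c²T)² · (c⁴ X) = γ/T² · X` (`c ≠ 0`; no hypothesis on `T`, the junk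
value `x/0 = 0` matching on both sides). [formal bookkeeping] -/
theorem greenKubo_prefactor_smul {c : ℝ} (hc : c ≠ 0) (γ T X : ℝ) :
    γ / (c ^ 2 * T) ^ 2 * (c ^ 4 * X) = γ / T ^ 2 * X := by
  have hc4 : c ^ 4 ≠ 0 := pow_ne_zero 4 hc
  calc γ / (c ^ 2 * T) ^ 2 * (c ^ 4 * X) = γ * c ^ 4 / (T ^ 2 * c ^ 4) * X := by ring
    _ = γ / T ^ 2 * X := by rw [mul_div_mul_right _ _ hc4]

/-- **The two-exit survival function is scale INVARIANT**: `S^{lam,β}_N(t; c²T) = S^{lam c²,β c²}_N(t; T)`. [folklore] -/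
theorem survival_smul {ω₂ lam β γ : ℝ} (hω : 0 < ω₂) (hl : 0 ≤ lam) (hβ : 0 ≤ β) (hγ : 0 ≤ γ)
    {c : ℝ} (hc : 0 < c) (T : ℝ) (N : ℕ) (t : ℝ) :
    survival ω₂ lam β γ (c ^ 2 * T) N t = survival ω₂ (lam * c ^ 2) (β * c ^ 2) γ T N t := by
  unfold survival
  simp only [escapeKernel_smul hω hl hβ hγ hc, crossKernel_smul hω hl hβ hγ hc, ← mul_add, integral_const_mul]
  exact greenKubo_prefactor_smul hc.ne' γ T _

/-- **The escape deficit is scale INVARIANT**: `E^{lam,β}_N(c²T) = E^{lam c²,β c²}_N(T)`. [folklore] -/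
theorem escapeDeficit_smul {ω₂ lam β γ : ℝ} (hω : 0 < ω₂) (hl : 0 ≤ lam) (hβ : 0 ≤ β) (hγ : 0 ≤ γ)
    {c : ℝ} (hc : 0 < c) (T : ℝ) (N : ℕ) :
    escapeDeficit ω₂ lam β γ (c ^ 2 * T) N = escapeDeficit ω₂ (lam * c ^ 2) (β * c ^ 2) γ T N := by
  rw [escapeDeficit_eq, escapeDeficit_eq]
  simp only [escapeKernel_smul hω hl hβ hγ hc, integral_const_mul]
  rw [greenKubo_prefactor_smul hc.ne']

/-- The step response is scale invariant: `θ^{lam,β}_N(s; c²T) = θ^{lam c²,β c²}_N(s; T)`. [folklore] -/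
theorem stepResponse_smul {ω₂ lam β γ : ℝ} (hω : 0 < ω₂) (hl : 0 ≤ lam) (hβ : 0 ≤ β) (hγ : 0 ≤ γ)
    {c : ℝ} (hc : 0 < c) (T : ℝ) (N : ℕ) (s : ℝ) :
    stepResponse ω₂ lam β γ (c ^ 2 * T) N s = stepResponse ω₂ (lam * c ^ 2) (β * c ^ 2) γ T N s := by
  unfold stepResponse
  simp only [escapeKernel_smul hω hl hβ hγ hc, intervalIntegral.integral_const_mul]
  exact greenKubo_prefactor_smul hc.ne' γ T _

/-- The Cesàro deficit is scale invariant: `W^{lam,β}_N(t; c²T) = W^{lam c²,β c²}_N(t; T)`. [folklore] -/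
theorem deficitCesaro_smul {ω₂ lam β γ : ℝ} (hω : 0 < ω₂) (hl : 0 ≤ lam) (hβ : 0 ≤ β) (hγ : 0 ≤ γ)
    {c : ℝ} (hc : 0 < c) (T : ℝ) (N : ℕ) (t : ℝ) :
    deficitCesaro ω₂ lam β γ (c ^ 2 * T) N t = deficitCesaro ω₂ (lam * c ^ 2) (β * c ^ 2) γ T N t := by
  unfold deficitCesaro
  simp only [stepResponse_smul hω hl hβ hγ hc]

/-! ## §4b The storage / leak ledger of the lineage (objects of 95E/96S): energies have weight two -/

/-- Mean energy: `⟨H_{lam,β}⟩_{μ_{c²T}} = c²·⟨H_{lam c²,β c²}⟩_{μ_T}` (`c ≠ 0`). [folklore] -/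
theorem integral_hamiltonian_gibbsMeasure_smul (ω₂ lam β γ : ℝ) {c : ℝ} (hc : c ≠ 0) (N : ℕ) (T : ℝ) :
    ∫ x, (pinnedChain ω₂ lam β γ).hamiltonian N x ∂((pinnedChain ω₂ lam β γ).gibbsMeasure N (c ^ 2 * T)) =
      c ^ 2 * ∫ y, (pinnedChain ω₂ (lam * c ^ 2) (β * c ^ 2) γ).hamiltonian N y
        ∂((pinnedChain ω₂ (lam * c ^ 2) (β * c ^ 2) γ).gibbsMeasure N T) := by
  rw [integral_gibbsMeasure_smul ω₂ lam β γ hc]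
  simp only [hamiltonian_smul]
  exact integral_const_mul _ _

/-- The propagated corrector has weight two: `(P_t h_b)^{c²T}(c·z) = c²·(P_t h_b)^{T}(z)`. [folklore] -/
theorem corrAct_smul {ω₂ lam β γ : ℝ} (hω : 0 < ω₂) (hl : 0 ≤ lam) (hβ : 0 ≤ β) (hγ : 0 ≤ γ)
    {c : ℝ} (hc : 0 < c) (T : ℝ) (N : ℕ) (b : Fin N) (t : ℝ) (z : PhaseSpace N) :
    corrAct ω₂ lam β γ (c ^ 2 * T) N b t (c • z) = c ^ 2 * corrAct ω₂ (lam * c ^ 2) (β * c ^ 2) γ T N b t z := by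
  unfold corrAct
  rw [integral_transitionKernel_smul hω hl hβ hγ hc]
  simp only [kinCorrector_smul hω hl hβ hγ hc]
  exact integral_const_mul _ _

/-- **The storage kernel scales by `c⁴`**: `g^{lam,β}_N(s; c²T) = c⁴·g^{lam c²,β c²}_N(s; T)` (`θ₀` and `H − ⟨H⟩` both of weight
two). [folklore] -/
theorem storageKernel_smul {ω₂ lam β γ : ℝ} (hω : 0 < ω₂) (hl : 0 ≤ lam) (hβ : 0 ≤ β) (hγ : 0 ≤ γ)
    {c : ℝ} (hc : 0 < c) (T : ℝ) (N : ℕ) (s : ℝ) :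
    storageKernel ω₂ lam β γ (c ^ 2 * T) N s = c ^ 4 * storageKernel ω₂ (lam * c ^ 2) (β * c ^ 2) γ T N s := by
  unfold storageKernel
  split_ifs with hN
  · simp only [integral_gibbsMeasure_smul ω₂ lam β γ hc.ne', integral_transitionKernel_smul hω hl hβ hγ hc, kinObs_smul,
      hamiltonian_smul, integral_const_mul, ← mul_sub]
    rw [← integral_const_mul]
    refine integral_congr_ae (Filter.Eventually.of_forall fun z => ?_)
    ring
  · simp

/-- **The energy variance scales by `c⁴`**: `Var_{μ_{c²T}}(H_{lam,β}) = c⁴·Var_{μ_T}(H_{lam c²,β c²})` (`c ≠ 0`). [folklore] -/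
theorem energyVariance_smul (ω₂ lam β γ : ℝ) {c : ℝ} (hc : c ≠ 0) (T : ℝ) (N : ℕ) :
    energyVariance ω₂ lam β γ (c ^ 2 * T) N = c ^ 4 * energyVariance ω₂ (lam * c ^ 2) (β * c ^ 2) γ T N := by
  unfold energyVariance
  simp only [integral_gibbsMeasure_smul ω₂ lam β γ hc, hamiltonian_smul, integral_const_mul, ← mul_sub]
  rw [← integral_const_mul]
  refine integral_congr_ae (Filter.Eventually.of_forall fun z => ?_)
  ring

/-- The energy–corrector pairing scales by `c⁴`: `Λ^{lam,β}_N(c²T) = c⁴·Λ^{lam c²,β c²}_N(T)`. [folklore] -/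
theorem energyPairing_smul {ω₂ lam β γ : ℝ} (hω : 0 < ω₂) (hl : 0 ≤ lam) (hβ : 0 ≤ β) (hγ : 0 ≤ γ)
    {c : ℝ} (hc : 0 < c) (T : ℝ) (N : ℕ) :
    energyPairing ω₂ lam β γ (c ^ 2 * T) N = c ^ 4 * energyPairing ω₂ (lam * c ^ 2) (β * c ^ 2) γ T N := by
  unfold energyPairing
  split_ifs with hN
  · simp only [integral_gibbsMeasure_smul ω₂ lam β γ hc.ne', hamiltonian_smul, kinCorrector_smul hω hl hβ hγ hc,
      integral_const_mul, ← mul_sub]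
    rw [← integral_const_mul]
    refine integral_congr_ae (Filter.Eventually.of_forall fun z => ?_)
    ring
  · simp

/-- **The storage functional is scale INVARIANT**: `S^{stor; lam,β}_N(t; c²T) = S^{stor; lam c²,β c²}_N(t; T)` (the prefactor `1/T²`
absorbs the weight four of `(H − ⟨H⟩)·(h₀ − P_t h₀)`). [folklore] -/
theorem storageResponse_smul {ω₂ lam β γ : ℝ} (hω : 0 < ω₂) (hl : 0 ≤ lam) (hβ : 0 ≤ β) (hγ : 0 ≤ γ)
    {c : ℝ} (hc : 0 < c) (T : ℝ) (N : ℕ) (t : ℝ) :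
    storageResponse ω₂ lam β γ (c ^ 2 * T) N t = storageResponse ω₂ (lam * c ^ 2) (β * c ^ 2) γ T N t := by
  unfold storageResponse
  split_ifs with hN
  · simp only [integral_gibbsMeasure_smul ω₂ lam β γ hc.ne', hamiltonian_smul, kinCorrector_smul hω hl hβ hγ hc,
      corrAct_smul hω hl hβ hγ hc, integral_const_mul, ← mul_sub]
    rw [← greenKubo_prefactor_smul hc.ne' 1 T]
    congr 1
    rw [← integral_const_mul]
    refine integral_congr_ae (Filter.Eventually.of_forall fun z => ?_)
    ring
  · rfl

/-- **The leak functional is scale INVARIANT**: `F^{lam,β}_N(t; c²T) = F^{lam c²,β c²}_N(t; T)` (time reversal `Θ` commutes with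
`S_c`). [folklore] -/
theorem leakResponse_smul {ω₂ lam β γ : ℝ} (hω : 0 < ω₂) (hl : 0 ≤ lam) (hβ : 0 ≤ β) (hγ : 0 ≤ γ)
    {c : ℝ} (hc : 0 < c) (T : ℝ) (N : ℕ) (t : ℝ) :
    leakResponse ω₂ lam β γ (c ^ 2 * T) N t = leakResponse ω₂ (lam * c ^ 2) (β * c ^ 2) γ T N t := by
  unfold leakResponse
  split_ifs with hN
  · have hflip : ∀ z : PhaseSpace N, (((c • z).1, -(c • z).2) : PhaseSpace N) = c • (z.1, -z.2) := fun z => by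
      simp only [Prod.smul_fst, Prod.smul_snd, Prod.smul_mk, smul_neg]
    simp only [integral_gibbsMeasure_smul ω₂ lam β γ hc.ne', hflip, kinCorrector_smul hω hl hβ hγ hc,
      corrAct_smul hω hl hβ hγ hc, escapeDeficit_smul hω hl hβ hγ hc, ← mul_sub]
    rw [← greenKubo_prefactor_smul hc.ne' γ T]
    congr 2
    rw [← integral_const_mul]
    refine integral_congr_ae (Filter.Eventually.of_forall fun z => ?_)
    ring
  · rfl

/-- The escape transient is scale invariant: `Ov^{lam,β}_N(t; c²T) = Ov^{lam c²,β c²}_N(t; T)`. [folklore] -/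
theorem escapeTransient_smul {ω₂ lam β γ : ℝ} (hω : 0 < ω₂) (hl : 0 ≤ lam) (hβ : 0 ≤ β) (hγ : 0 ≤ γ)
    {c : ℝ} (hc : 0 < c) (T : ℝ) (N : ℕ) (t : ℝ) :
    escapeTransient ω₂ lam β γ (c ^ 2 * T) N t = escapeTransient ω₂ (lam * c ^ 2) (β * c ^ 2) γ T N t := by
  unfold escapeTransient
  simp only [escapeKernel_smul hω hl hβ hγ hc]
  rw [← greenKubo_prefactor_smul hc.ne' γ T]
  congr 1
  rw [← integral_const_mul]
  refine integral_congr_ae (Filter.Eventually.of_forall fun u => ?_)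
  ring

/-! ## §5 Normal form `T ↦ 1`: the escape currency lives on the ray `(T·lam, T·β)` -/

/-- **Unit-temperature normal form of the escape deficit**: `E_N(lam, β; T) = E_N(T·lam, T·β; 1)` (`T > 0`; `c = √T`). [folklore] -/
theorem escapeDeficit_eq_unitTemperature {ω₂ lam β γ : ℝ} (hω : 0 < ω₂) (hl : 0 ≤ lam) (hβ : 0 ≤ β) (hγ : 0 ≤ γ)
    {T : ℝ} (hT : 0 < T) (N : ℕ) :
    escapeDeficit ω₂ lam β γ T N = escapeDeficit ω₂ (T * lam) (T * β) γ 1 N := by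
  have h := escapeDeficit_smul hω hl hβ hγ (Real.sqrt_pos.2 hT) 1 N
  rw [Real.sq_sqrt hT.le, mul_one, mul_comm lam, mul_comm β] at h
  exact h

/-- **Unit-temperature normal form of the survival function**: `S_N(t; lam, β; T) = S_N(t; T·lam, T·β; 1)`. [folklore] -/
theorem survival_eq_unitTemperature {ω₂ lam β γ : ℝ} (hω : 0 < ω₂) (hl : 0 ≤ lam) (hβ : 0 ≤ β) (hγ : 0 ≤ γ)
    {T : ℝ} (hT : 0 < T) (N : ℕ) (t : ℝ) :
    survival ω₂ lam β γ T N t = survival ω₂ (T * lam) (T * β) γ 1 N t := by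
  have h := survival_smul hω hl hβ hγ (Real.sqrt_pos.2 hT) 1 N t
  rw [Real.sq_sqrt hT.le, mul_one, mul_comm lam, mul_comm β] at h
  exact h

/-- **Unit-temperature normal form of the escape kernel**: `K_N(u; lam, β; T) = T²·K_N(u; T·lam, T·β; 1)`. [folklore] -/
theorem escapeKernel_eq_unitTemperature {ω₂ lam β γ : ℝ} (hω : 0 < ω₂) (hl : 0 ≤ lam) (hβ : 0 ≤ β) (hγ : 0 ≤ γ)
    {T : ℝ} (hT : 0 < T) (N : ℕ) (u : ℝ) :
    escapeKernel ω₂ lam β γ T N u = T ^ 2 * escapeKernel ω₂ (T * lam) (T * β) γ 1 N u := by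
  have h := escapeKernel_smul hω hl hβ hγ (Real.sqrt_pos.2 hT) 1 N u
  have h4 : Real.sqrt T ^ 4 = T ^ 2 := by
    rw [show (4 : ℕ) = 2 * 2 from rfl, pow_mul, Real.sq_sqrt hT.le]
  rw [h4, Real.sq_sqrt hT.le, mul_one, mul_comm lam, mul_comm β] at h
  exact h

/-- **Unit-temperature normal form of the cross kernel**: `K×_N(u; lam, β; T) = T²·K×_N(u; T·lam, T·β; 1)`. [folklore] -/
theorem crossKernel_eq_unitTemperature {ω₂ lam β γ : ℝ} (hω : 0 < ω₂) (hl : 0 ≤ lam) (hβ : 0 ≤ β) (hγ : 0 ≤ γ)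
    {T : ℝ} (hT : 0 < T) (N : ℕ) (u : ℝ) :
    crossKernel ω₂ lam β γ T N u = T ^ 2 * crossKernel ω₂ (T * lam) (T * β) γ 1 N u := by
  have h := crossKernel_smul hω hl hβ hγ (Real.sqrt_pos.2 hT) 1 N u
  have h4 : Real.sqrt T ^ 4 = T ^ 2 := by
    rw [show (4 : ℕ) = 2 * 2 from rfl, pow_mul, Real.sq_sqrt hT.le]
  rw [h4, Real.sq_sqrt hT.le, mul_one, mul_comm lam, mul_comm β] at h
  exact h

/-- **Ray invariance**: the escape deficit depends on `(lam, β, T)` only through `(T·lam, T·β)` —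
`T·lam = T'·lam'` and `T·β = T'·β'` (`T, T' > 0`) give `E_N(lam,β;T) = E_N(lam',β';T')`. [folklore] -/
theorem escapeDeficit_eq_of_ray {ω₂ γ : ℝ} (hω : 0 < ω₂) (hγ : 0 ≤ γ) {lam β T lam' β' T' : ℝ}
    (hl : 0 ≤ lam) (hβ : 0 ≤ β) (hT : 0 < T) (hl' : 0 ≤ lam') (hβ' : 0 ≤ β') (hT' : 0 < T')
    (h₁ : T * lam = T' * lam') (h₂ : T * β = T' * β') (N : ℕ) :
    escapeDeficit ω₂ lam β γ T N = escapeDeficit ω₂ lam' β' γ T' N := by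
  rw [escapeDeficit_eq_unitTemperature hω hl hβ hγ hT, escapeDeficit_eq_unitTemperature hω hl' hβ' hγ hT', h₁, h₂]

/-- **`OhmicFloor` is its own `T = 1` slice.**  11071's equivalent `OhmicFloor` (`∀ couplings ∀ T > 0 ∃ C₁ N₀ ∀ N ≥ N₀, E_N ≤ C₁/N`)
holds iff it holds at `T = 1` for all couplings (`⟸`: apply the slice to `(T·lam, T·β)` and `escapeDeficit_eq_unitTemperature`).
Every floor / window / tail statement beneath the waypoint may therefore be proved at unit temperature. [folklore] -/
theorem ohmicFloor_iff_unitTemperature :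
    OhmicFloor ↔
      ∀ ω₂ lam β γ : ℝ, 0 < ω₂ → 0 < lam → 0 < β → 0 < γ →
        ∃ C₁ : ℝ, ∃ N₀ : ℕ, ∀ N : ℕ, N₀ ≤ N → escapeDeficit ω₂ lam β γ 1 N ≤ C₁ / (N : ℝ) := by
  constructor
  · intro h ω₂ lam β γ hω hl hβ hγ
    exact h ω₂ lam β γ hω hl hβ hγ 1 one_pos
  · intro h ω₂ lam β γ hω hl hβ hγ T hT
    obtain ⟨C₁, N₀, hC⟩ := h ω₂ (T * lam) (T * β) γ hω (mul_pos hT hl) (mul_pos hT hβ) hγ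
    refine ⟨C₁, N₀, fun N hN => ?_⟩
    rw [escapeDeficit_eq_unitTemperature hω hl.le hβ.le hγ.le hT]
    exact hC N hN

/-- **11071 is its own `T = 1` slice** (`BoundedResponse ⟺ OhmicFloor ⟺ OhmicFloor|_{T=1}`). [folklore] -/
theorem boundedResponse_iff_unitTemperature :
    BoundedResponse ↔
      ∀ ω₂ lam β γ : ℝ, 0 < ω₂ → 0 < lam → 0 < β → 0 < γ →
        ∃ C₁ : ℝ, ∃ N₀ : ℕ, ∀ N : ℕ, N₀ ≤ N → escapeDeficit ω₂ lam β γ 1 N ≤ C₁ / (N : ℝ) :=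
  ohmicFloor_iff_boundedResponse.symm.trans ohmicFloor_iff_unitTemperature

/-- **Low temperature IS weak anharmonicity, at the level of the escape currency**: along `T ↦ E_N(lam, β; T)` one reads the
coupling ray `s ↦ E_N(s·lam, s·β; 1)`; hence the `T → 0⁺` limit in `LowTemperatureContinuity` is the `s → 0⁺` limit along the
ray, and a bound uniform in `T ∈ (0, T₀]` at fixed couplings is a bound uniform on the ray segment `{(s lam, s β) : 0 < s ≤ T₀}`
at `T = 1` — stated as the equality of the two functions on `(0, ∞)`. [folklore] -/
theorem escapeDeficit_eqOn_ray {ω₂ lam β γ : ℝ} (hω : 0 < ω₂) (hl : 0 ≤ lam) (hβ : 0 ≤ β) (hγ : 0 ≤ γ) (N : ℕ) :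
    EqOn (fun T : ℝ => escapeDeficit ω₂ lam β γ T N) (fun s : ℝ => escapeDeficit ω₂ (s * lam) (s * β) γ 1 N) (Ioi 0) :=
  fun _ hT => escapeDeficit_eq_unitTemperature hω hl hβ hγ hT N

/-- **The tree's `LowTemperatureContinuity` read on the coupling ray**: its `T → 0⁺` limit at fixed `(lam, β)` IS the limit of the
unit-temperature escape deficit along the ray `s ↦ (s·lam, s·β)` at its harmonic endpoint `(0, 0)` — the two `Tendsto` statements are
equivalent term by term (`escapeDeficit_eq_unitTemperature` on `(0, ∞)`), and the tree's limit value `E_N(0, 0; 1)` is exactly the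
ray's endpoint value. [folklore] -/
theorem lowTemperatureContinuity_iff_ray :
    LowTemperatureContinuity ↔
      ∀ ω₂ lam β γ : ℝ, 0 < ω₂ → 0 < lam → 0 < β → 0 < γ → ∀ N : ℕ, 2 ≤ N →
        Tendsto (fun s : ℝ => escapeDeficit ω₂ (s * lam) (s * β) γ 1 N) (𝓝[>] 0) (𝓝 (escapeDeficit ω₂ 0 0 γ 1 N)) := by
  unfold LowTemperatureContinuity
  refine forall₄_congr fun ω₂ lam β γ => ?_
  refine imp_congr_right fun hω => imp_congr_right fun hl => imp_congr_right fun hβ => imp_congr_right fun hγ => ?_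
  refine forall₂_congr fun N _ => ?_
  exact tendsto_congr' (eventually_nhdsWithin_of_forall fun T hT => escapeDeficit_eq_unitTemperature hω hl.le hβ.le hγ.le hT N)

/-- **The tree's `UniformOhmicFloor` read on the coupling ray**: an ohmic floor uniform in `T ∈ (0, T₀]` at fixed couplings is,
literally, an ohmic floor uniform on the INITIAL SEGMENT `{(s·lam, s·β) : 0 < s ≤ T₀}` of the coupling ray at `T = 1` — a uniform
WEAK-ANHARMONICITY statement (the tree tags it STRONGER than 11071 and refutes it given `PointwiseHarmonicLimit`,
`not_uniformOhmicFloor_of_pointwise`); this is the precise sense in which critic row 1382 (i) found the uniform supplier (U) of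
SEED-g98 inadmissible. [folklore] -/
theorem uniformOhmicFloor_iff_ray :
    UniformOhmicFloor ↔
      ∀ ω₂ lam β γ : ℝ, 0 < ω₂ → 0 < lam → 0 < β → 0 < γ →
        ∃ C₁ : ℝ, ∃ T₀ : ℝ, 0 < T₀ ∧ ∃ N₀ : ℕ, ∀ s : ℝ, 0 < s → s ≤ T₀ → ∀ N : ℕ, N₀ ≤ N →
          escapeDeficit ω₂ (s * lam) (s * β) γ 1 N ≤ C₁ / (N : ℝ) := by
  unfold UniformOhmicFloor
  refine forall₄_congr fun ω₂ lam β γ => ?_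
  refine imp_congr_right fun hω => imp_congr_right fun hl => imp_congr_right fun hβ => imp_congr_right fun hγ => ?_
  refine exists_congr fun C₁ => exists_congr fun T₀ => and_congr_right fun _ => exists_congr fun N₀ => ?_
  refine forall₂_congr fun s hs => forall_congr' fun _ => forall₂_congr fun N _ => ?_
  rw [escapeDeficit_eq_unitTemperature hω hl.le hβ.le hγ.le hs N]

end ThermalScaling

end Summit.AtomisticToContinuum.FouriersLaw.Theorems.BoundedResponse.ParityFloor
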